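import Summits.AtomisticToContinuum.BoseEinsteinCondensation.Theorems.BECInsertionCorrectorCorrectorClosureChemicalPotentialBorn
import HarnessLib

/-!
# Crux `PuffFloor` (stmt-AtomisticToContinuum-11785), line `coupling-slope-pocket` —
registered stub `stub_removalEnergy` (S7b: the two-particle removal energy is `O(ρ)`)

Supports (does not close) stmt-AtomisticToContinuum-11785, route `BECConjugateDomination`.
A registered stub of the lead's skeleton `Cruxes/PuffFloor/Lines/coupling-slope-pocket.lean`, in the
torus vocabulary of `Literature/MathematicalPhysics/QuantumManyBody/PeriodicBoseGas*.lean` (cell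
`[0,L)³ = cell L`, periodised pair potential `v^per = periodizedPotential v L`, bosonic periodic
ground-state energies `periodicGroundStateEnergy v N L = E^per(N, L)`).

**Statement.** For a measurable pair potential `v ≥ 0` (hard cores allowed), every `n` and every
torus of side `L > 0`, the two-particle removal energy `μ₂ = E^per(n+2, L) - E^per(n, L)` is at most
`(2n+1)` uniform Born terms:
`E^per(n+2, L) ≤ E^per(n, L) + (2n+1) L⁻³ ∫_{ℝ³} v(|x|) dx` (in `ℝ≥0∞`).

**Proof.** Insert the two extra particles one at a time in the normalised constant mode
`φ₀ ≡ L^{-3/2}` (LSSY2005, proof of Thm. 2.2, constant trial factors; the bosonic ground-state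
energy is the absolute one, `BosonicFloor.lean`, so no symmetrisation is needed). One insertion on
top of `N` bosons costs at most the cell average `N L⁻³ ∫_{[0,L)³} v^per` of the pinned-scatterer
potential — the in-tree chemical-potential bound
`CorrectorClosure.HealingScaleKacInsertion.periodicGroundStateEnergy_succ_le_add_born`
(`E^per(N+1, L) ≤ E^per(N, L) + N (L³)⁻¹ ∫_{[0,L)³} v^per`) — and
`∫_{[0,L)³} v^per = ∫_{ℝ³} v(|x|) dx` because the cell tiles `ℝ³` under `Lℤ³`
(`lintegral_cell_periodizedPotential_sub`). Chaining the insertions `n → n+1 → n+2` costs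
`(n + (n+1)) L⁻³ ∫ v = (2n+1) L⁻³ ∫ v`.
-/

noncomputable section

namespace Summit.AtomisticToContinuum.BoseEinsteinCondensation.Theorems

open MeasureTheory Filter
open scoped ENNReal NNReal BigOperators
open Literature.MathematicalPhysics.QuantumManyBody.BoseGas

namespace PuffFloorRemovalEnergy

/-- **Unfolding the periodisation on the cell**: `∫_{[0,L)³} v^per(x) dx = ∫_{ℝ³} v(|x|) dx`
for `L > 0` and measurable `v` (the case `y = 0` of `lintegral_cell_periodizedPotential_sub`).
[folklore] -/
theorem lintegral_cell_periodizedPotential {L : ℝ} (hL : 0 < L) {v : ℝ → ℝ≥0∞}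
    (hv : Measurable v) :
    ∫⁻ x in cell L, periodizedPotential v L x = ∫⁻ x : Space, v ‖x‖ := by
  simpa only [sub_zero] using lintegral_cell_periodizedPotential_sub hL hv 0

/-- **One constant-mode insertion** in the units of the stub: for measurable `v`, `L > 0` and every
`N`, `E^per(N+1, L) ≤ E^per(N, L) + N · (ofReal (L³))⁻¹ · ∫_{ℝ³} v(|x|) dx`. [folklore] -/
theorem periodicGroundStateEnergy_succ_le {v : ℝ → ℝ≥0∞} (hv : Measurable v) (N : ℕ) {L : ℝ}
    (hL : 0 < L) :
    periodicGroundStateEnergy v (N + 1) L ≤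
      periodicGroundStateEnergy v N L +
        (N : ℝ≥0∞) * (ENNReal.ofReal (L ^ 3))⁻¹ * ∫⁻ x : Space, v ‖x‖ := by
  rw [← lintegral_cell_periodizedPotential hL hv]
  exact CorrectorClosure.HealingScaleKacInsertion.periodicGroundStateEnergy_succ_le_add_born
    v hv N L hL

/-- The coefficient of the stub: `ofReal ((2n+1)/L³) = (n + (n+1)) · (ofReal (L³))⁻¹` in `ℝ≥0∞`
for `L > 0`. [folklore] -/
theorem ofReal_two_mul_add_one_div (n : ℕ) {L : ℝ} (hL : 0 < L) :
    ENNReal.ofReal ((2 * (n : ℝ) + 1) / L ^ 3) =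
      ((n : ℝ≥0∞) + ((n + 1 : ℕ) : ℝ≥0∞)) * (ENNReal.ofReal (L ^ 3))⁻¹ := by
  have hL3 : 0 < L ^ 3 := by positivity
  have h2n : (0 : ℝ) ≤ 2 * (n : ℝ) + 1 := by positivity
  rw [div_eq_mul_inv, ENNReal.ofReal_mul h2n, ENNReal.ofReal_inv_of_pos hL3]
  congr 1
  have hcast : (2 * (n : ℝ) + 1) = ((2 * n + 1 : ℕ) : ℝ) := by push_cast; ring
  rw [hcast, ENNReal.ofReal_natCast]
  push_cast
  ring

end PuffFloorRemovalEnergy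

/-- **S7b `stub_removalEnergy` — the two-particle removal energy is `O(ρ)`.** For every measurable
`v ≥ 0` (hard cores allowed), every `n` and every `L > 0`,
`E^per(n+2, L) ≤ E^per(n, L) + (2n+1) L⁻³ ∫_{ℝ³} v(|x|) dx` in `ℝ≥0∞`: two successive constant-mode
insertions (`PuffFloorRemovalEnergy.periodicGroundStateEnergy_succ_le`, i.e. the chemical-potential
bound `periodicGroundStateEnergy_succ_le_add_born` with the periodisation unfolded) cost `n` and
`n+1` Born terms `L⁻³ ∫ v`. [folklore] -/
theorem stub_removalEnergy :
    ∀ v : ℝ → ℝ≥0∞, Measurable v → ∀ (n : ℕ) (L : ℝ), 0 < L →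
      periodicGroundStateEnergy v (n + 2) L ≤ periodicGroundStateEnergy v n L +
        ENNReal.ofReal ((2 * (n : ℝ) + 1) / L ^ 3) * ∫⁻ x : Space, v ‖x‖ := by
  intro v hv n L hL
  have h1 : periodicGroundStateEnergy v (n + 2) L ≤
      periodicGroundStateEnergy v (n + 1) L +
        ((n + 1 : ℕ) : ℝ≥0∞) * (ENNReal.ofReal (L ^ 3))⁻¹ * ∫⁻ x : Space, v ‖x‖ :=
    PuffFloorRemovalEnergy.periodicGroundStateEnergy_succ_le hv (n + 1) hL
  have h0 := PuffFloorRemovalEnergy.periodicGroundStateEnergy_succ_le hv n hL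
  calc periodicGroundStateEnergy v (n + 2) L
      ≤ periodicGroundStateEnergy v (n + 1) L +
          ((n + 1 : ℕ) : ℝ≥0∞) * (ENNReal.ofReal (L ^ 3))⁻¹ * ∫⁻ x : Space, v ‖x‖ := h1
    _ ≤ (periodicGroundStateEnergy v n L +
          (n : ℝ≥0∞) * (ENNReal.ofReal (L ^ 3))⁻¹ * ∫⁻ x : Space, v ‖x‖) +
          ((n + 1 : ℕ) : ℝ≥0∞) * (ENNReal.ofReal (L ^ 3))⁻¹ * ∫⁻ x : Space, v ‖x‖ :=
        add_le_add h0 le_rfl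
    _ = periodicGroundStateEnergy v n L +
          ENNReal.ofReal ((2 * (n : ℝ) + 1) / L ^ 3) * ∫⁻ x : Space, v ‖x‖ := by
        rw [PuffFloorRemovalEnergy.ofReal_two_mul_add_one_div n hL, add_mul, add_mul, add_assoc]

end Summit.AtomisticToContinuum.BoseEinsteinCondensation.Theorems

end
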